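import Summits.Ventures.PercRepro.BridgeRows
import Summits.Ventures.PercRepro.LemmaB3

/-!
# PercRepro — THE 2|2 BRIDGE CASE OF LEMMA B⁺ IS A THEOREM (p1, gen 4; proofs/P1-bridge-lemma.md §1)

For marked multigraphs `(G₁; a, b, h₁)` and `(G₂; c, d, h₂)`, the C-011 class sum of the 1-sum
`G₁.bridgeSum G₂ h₁ h₂` with marks `inl a, inl b, inr c, inr d` is `N₁·N₂ − M₁·M₂` (`cubeSumC011_bridgeSum_eq`):
`N_i` = the `(⊤₃, a ≁ b)` antipodal count of the half, `M_i` = the `(a ~ b, exactly one of a, b joined to the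
bridge end)` count; and `N_i ≥ M_i ≥ 0` follows pointwise from the kernel-checked Lemma B₃
(`LemmaB3Abstract_holds_classwise`: `N − M = #(⊤₃,⊥₃) − #(y_ab,y_ah) − #(y_ab,y_bh) ≥ #(y_ah,y_bh) ≥ 0`), so
**`0 ≤ CS(G₁ ⊕_bridge G₂; a, b, c, d)`** (`cubeSumC011_bridgeSum_nonneg`): Lemma B⁺, hence C-011 at every `p`
(typer-2's antipodal principle), holds on every graph with a bridge separating two marks from the other two,
with no induction hypothesis.
-/

namespace PercRepro

open Finset

/-- The Boolean form of the Lemma-B₃ kernel bound on one half (64 cases): the half's `(⊤, ¬a~b)` count minus its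
`(a~b, exactly one)` count dominates the `(⊤₃, ⊥₃)` count minus the count of the three crossing pairs. -/
theorem half_bound : ∀ A X X' A' X'' X''' : Bool, Tr3 A X X' → Tr3 A' X'' X''' →
    (if A && X && X' && !A' && !X'' && !X''' then (1 : ℤ) else 0) -
      (if (A && !X && !X' && ((!A' && X'' && !X''') || (!A' && !X'' && X'''))) ||
          (!A && X && !X' && !A' && !X'' && X''') then (1 : ℤ) else 0) ≤
    (if A && X && X' && !A' then (1 : ℤ) else 0) - (if A && (X'' != X''') then (1 : ℤ) else 0) := by
  decide

/-- The `(⊤, ⊥)` bridge term is a product of the two halves' terms (256 cases). -/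
theorem prod_top_split : ∀ A X X' C Y Y' A' C' : Bool,
    (if A && X && X' && C && Y && Y' && !A' && !C' then (1 : ℤ) else 0) =
      (if A && X && X' && !A' then (1 : ℤ) else 0) * (if C && Y && Y' && !C' then (1 : ℤ) else 0) := by
  decide

/-- The liability bridge term is a product of the two halves' terms (64 cases). -/
theorem prod_liab_split : ∀ A C X'' X''' Y'' Y''' : Bool,
    (if A && C && (X'' != X''') && (Y'' != Y''') then (1 : ℤ) else 0) =
      (if A && (X'' != X''') then (1 : ℤ) else 0) * (if C && (Y'' != Y''') then (1 : ℤ) else 0) := by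
  decide

namespace MultiGraph

section Half

variable {V E : Type} (G : MultiGraph V E)

open Classical in
/-- The `(⊤₃, a ≁ b)` indicator of a half: all three of `a, b, h` connected in `ω`, `a ≁ b` in `ωᶜ`. -/
noncomputable def pTop (ω : Config E) (a b h : V) : ℤ :=
  if decide (G.Conn ω a b) && decide (G.Conn ω a h) && decide (G.Conn ω b h) && !decide (G.Conn ωᶜ a b) then 1
  else 0

open Classical in
/-- The liability indicator of a half: `a ~ b` in `ω`, exactly one of `a, b` joined to `h` in `ωᶜ`. -/
noncomputable def qLiab (ω : Config E) (a b h : V) : ℤ :=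
  if decide (G.Conn ω a b) && (decide (G.Conn ωᶜ a h) != decide (G.Conn ωᶜ b h)) then 1 else 0

/-- The three-mark partition of a half. -/
noncomputable abbrev halfPart (a b h : V) : Config E → Setoid (Fin 3) :=
  fun ω => G.markedPartition ω ![a, b, h]

/-- If the half partition is `⊤`, the three marks are pairwise connected. -/
theorem conn_of_halfPart_eq_top {ω : Config E} {a b h : V} (ht : G.halfPart a b h ω = ⊤) :
    G.Conn ω a b ∧ G.Conn ω a h ∧ G.Conn ω b h := by
  have := Setoid.eq_top_iff.1 ht
  exact ⟨this 0 1, this 0 2, this 1 2⟩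

/-- If the half partition is `⊥`, no two of the three marks are connected. -/
theorem not_conn_of_halfPart_eq_bot {ω : Config E} {a b h : V} (hb : G.halfPart a b h ω = ⊥) :
    ¬ G.Conn ω a b ∧ ¬ G.Conn ω a h ∧ ¬ G.Conn ω b h := by
  refine ⟨fun h' => ?_, fun h' => ?_, fun h' => ?_⟩
  · have : G.halfPart a b h ω 0 1 := h'
    rw [hb] at this
    exact absurd (show (0 : Fin 3) = 1 from this) (by decide)
  · have : G.halfPart a b h ω 0 2 := h'
    rw [hb] at this
    exact absurd (show (0 : Fin 3) = 2 from this) (by decide)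
  · have : G.halfPart a b h ω 1 2 := h'
    rw [hb] at this
    exact absurd (show (1 : Fin 3) = 2 from this) (by decide)

/-- `a ~ b` only: the half partition is `cross3 0 = ab|h`. -/
theorem halfPart_eq_cross3_zero {ω : Config E} {a b h : V} (h01 : G.Conn ω a b) (h02 : ¬ G.Conn ω a h)
    (h12 : ¬ G.Conn ω b h) : G.halfPart a b h ω = cross3 0 := by
  refine Setoid.ext fun x y => ?_
  rw [cross3_rel]
  have h10 : G.Conn ω b a := h01.symm
  have h20 : ¬ G.Conn ω h a := fun h' => h02 h'.symm
  have h21 : ¬ G.Conn ω h b := fun h' => h12 h'.symm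
  fin_cases x <;> fin_cases y <;>
    simp [markedPartition_rel, h01, h02, h12, h10, h20, h21]

/-- `a ~ h` only: the half partition is `cross3 1 = ah|b`. -/
theorem halfPart_eq_cross3_one {ω : Config E} {a b h : V} (h01 : ¬ G.Conn ω a b) (h02 : G.Conn ω a h)
    (h12 : ¬ G.Conn ω b h) : G.halfPart a b h ω = cross3 1 := by
  refine Setoid.ext fun x y => ?_
  rw [cross3_rel]
  have h20 : G.Conn ω h a := h02.symm
  have h10 : ¬ G.Conn ω b a := fun h' => h01 h'.symm
  have h21 : ¬ G.Conn ω h b := fun h' => h12 h'.symm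
  fin_cases x <;> fin_cases y <;>
    simp [markedPartition_rel, h01, h02, h12, h10, h20, h21]

/-- `b ~ h` only: the half partition is `cross3 2 = bh|a`. -/
theorem halfPart_eq_cross3_two {ω : Config E} {a b h : V} (h01 : ¬ G.Conn ω a b) (h02 : ¬ G.Conn ω a h)
    (h12 : G.Conn ω b h) : G.halfPart a b h ω = cross3 2 := by
  refine Setoid.ext fun x y => ?_
  rw [cross3_rel]
  have h21 : G.Conn ω h b := h12.symm
  have h10 : ¬ G.Conn ω b a := fun h' => h01 h'.symm
  have h20 : ¬ G.Conn ω h a := fun h' => h02 h'.symm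
  fin_cases x <;> fin_cases y <;>
    simp [markedPartition_rel, h01, h02, h12, h10, h20, h21]

open Classical in
/-- **Pointwise Lemma-B₃ bound on a half**: `pTop − qLiab` dominates the `(⊤, ⊥)` indicator minus the crossing
indicator of the half partition. -/
theorem pTop_sub_qLiab_ge (ω : Config E) (a b h : V) :
    (if G.halfPart a b h ω = ⊤ ∧ G.halfPart a b h ωᶜ = ⊥ then (1 : ℤ) else 0) -
      (if ∃ i j : Fin 3, i < j ∧ G.halfPart a b h ω = cross3 i ∧ G.halfPart a b h ωᶜ = cross3 j then (1 : ℤ)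
        else 0) ≤ G.pTop ω a b h - G.qLiab ω a b h := by
  have key := half_bound (decide (G.Conn ω a b)) (decide (G.Conn ω a h)) (decide (G.Conn ω b h))
    (decide (G.Conn ωᶜ a b)) (decide (G.Conn ωᶜ a h)) (decide (G.Conn ωᶜ b h))
    (G.tr3_tri ω a b h) (G.tr3_tri ωᶜ a b h)
  unfold pTop qLiab
  refine le_trans (sub_le_sub ?_ ?_) key
  · -- the `(⊤, ⊥)` indicator is at most its Boolean form
    split_ifs with h1 h2
    · exact le_rfl
    · exfalso
      obtain ⟨ht, hb⟩ := h1
      obtain ⟨c1, c2, c3⟩ := G.conn_of_halfPart_eq_top ht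
      obtain ⟨n1, n2, n3⟩ := G.not_conn_of_halfPart_eq_bot hb
      simp [c1, c2, c3, n1, n2, n3] at h2
    · exact (zero_le_one : (0 : ℤ) ≤ 1)
    · exact le_rfl
  · -- the crossing indicator is at least its Boolean form
    split_ifs with h1 h2
    · exact le_rfl
    · exfalso
      apply h2
      simp only [Bool.or_eq_true, Bool.and_eq_true, Bool.not_eq_eq_eq_not, Bool.not_true,
        decide_eq_true_eq, decide_eq_false_iff_not] at h1
      rcases h1 with ⟨⟨⟨c01, c02⟩, c12⟩, ⟨⟨n01, c02'⟩, n12'⟩ | ⟨⟨n01, n02'⟩, c12'⟩⟩ |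
        ⟨⟨⟨⟨⟨n01, c02⟩, n12⟩, n01'⟩, n02'⟩, c12'⟩
      · exact ⟨0, 1, by decide, G.halfPart_eq_cross3_zero c01 c02 c12,
          G.halfPart_eq_cross3_one n01 c02' n12'⟩
      · exact ⟨0, 2, by decide, G.halfPart_eq_cross3_zero c01 c02 c12,
          G.halfPart_eq_cross3_two n01 n02' c12'⟩
      · exact ⟨1, 2, by decide, G.halfPart_eq_cross3_one n01 c02 n12,
          G.halfPart_eq_cross3_two n01' n02' c12'⟩
    · exact neg_nonpos.2 (zero_le_one : (0 : ℤ) ≤ 1)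
    · exact le_rfl

/-- `pTop` is nonnegative. -/
theorem pTop_nonneg (ω : Config E) (a b h : V) : 0 ≤ G.pTop ω a b h := by
  unfold pTop; split_ifs <;> simp

/-- `qLiab` is nonnegative. -/
theorem qLiab_nonneg (ω : Config E) (a b h : V) : 0 ≤ G.qLiab ω a b h := by
  unfold qLiab; split_ifs <;> simp

variable [Fintype E] [DecidableEq E]

open Classical in
/-- **Lemma B₃ on a half**: `Σ_ω qLiab ≤ Σ_ω pTop`. -/
theorem sum_qLiab_le_sum_pTop (a b h : V) :
    ∑ ω : Config E, G.qLiab ω a b h ≤ ∑ ω : Config E, G.pTop ω a b h := by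
  have hB3 := LemmaB3Abstract_holds_classwise (G.halfPart a b h) (G.markedPartition_mono ![a, b, h])
  have htb : (topBotCount (G.halfPart a b h) : ℤ) =
      ∑ ω : Config E, if G.halfPart a b h ω = ⊤ ∧ G.halfPart a b h ωᶜ = ⊥ then (1 : ℤ) else 0 := by
    unfold topBotCount
    rw [Finset.card_filter]
    push_cast
    rfl
  have hcr : (crossCount cross3 (G.halfPart a b h) : ℤ) =
      ∑ ω : Config E, if ∃ i j : Fin 3, i < j ∧ G.halfPart a b h ω = cross3 i ∧
        G.halfPart a b h ωᶜ = cross3 j then (1 : ℤ) else 0 := by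
    unfold crossCount
    rw [Finset.card_filter]
    push_cast
    rfl
  have hsum := Finset.sum_le_sum fun ω (_ : ω ∈ (univ : Finset (Config E))) => G.pTop_sub_qLiab_ge ω a b h
  rw [Finset.sum_sub_distrib, Finset.sum_sub_distrib, ← htb, ← hcr] at hsum
  have : (crossCount cross3 (G.halfPart a b h) : ℤ) ≤ topBotCount (G.halfPart a b h) := by exact_mod_cast hB3
  linarith

end Half

section Bridge

variable {V₁ E₁ V₂ E₂ : Type}

/-- The cube of the 1-sum as the triple product of the two half cubes and the bridge bit. -/
def glueEquiv : Config E₁ × Config E₂ × Bool ≃ Config (E₁ ⊕ (E₂ ⊕ Unit)) :=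
  ((Equiv.refl (Config E₁)).prodCongr (((Equiv.refl (Config E₂)).prodCongr (Equiv.funUnique Unit Bool).symm).trans
    (Equiv.sumArrowEquivProdArrow E₂ Unit Bool).symm)).trans (Equiv.sumArrowEquivProdArrow E₁ (E₂ ⊕ Unit) Bool).symm

/-- `glueEquiv` is `glue`. -/
theorem glueEquiv_apply (ω₁ : Config E₁) (ω₂ : Config E₂) (β : Bool) :
    glueEquiv (ω₁, ω₂, β) = glue ω₁ ω₂ β := by
  funext e
  rcases e with e | e | e <;> rfl

variable [Fintype E₁] [DecidableEq E₁] [Fintype E₂] [DecidableEq E₂]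
  (G₁ : MultiGraph V₁ E₁) (G₂ : MultiGraph V₂ E₂) (h₁ : V₁) (h₂ : V₂)

open Classical in
/-- **The C-011 class sum of the 1-sum is `N₁·N₂ − M₁·M₂`.** -/
theorem cubeSumC011_bridgeSum_eq (a b : V₁) (c d : V₂) :
    (G₁.bridgeSum G₂ h₁ h₂).cubeSumC011 ![Sum.inl a, Sum.inl b, Sum.inr c, Sum.inr d] =
      ((∑ ω₁ : Config E₁, G₁.pTop ω₁ a b h₁) * (∑ ω₂ : Config E₂, G₂.pTop ω₂ c d h₂) -
        (∑ ω₁ : Config E₁, G₁.qLiab ω₁ a b h₁) * (∑ ω₂ : Config E₂, G₂.qLiab ω₂ c d h₂) : ℤ) := by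
  unfold cubeSumC011 cubeSum
  simp only [phiPlusKernel_eq_kplusZ, G₁.row4_bridgeSum G₂ h₁ h₂]
  rw [← (glueEquiv (E₁ := E₁) (E₂ := E₂)).sum_comp]
  simp only [Fintype.sum_prod_type, Fintype.sum_bool, glueEquiv_apply, compl_glue, leftCfg_glue, rightCfg_glue,
    bridgeBit_glue, Bool.not_true, Bool.not_false]
  -- the two bridge kernels
  have hT : ∀ (ω₁ : Config E₁) (ω₂ : Config E₂),
      (kplusZ (rowOf4 (bridgeRowVec (decide (G₁.Conn ω₁ a b)) (decide (G₁.Conn ω₁ a h₁)) (decide (G₁.Conn ω₁ b h₁))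
          (decide (G₂.Conn ω₂ c d)) (decide (G₂.Conn ω₂ h₂ c)) (decide (G₂.Conn ω₂ h₂ d)) true))
        (rowOf4 (bridgeRowVec (decide (G₁.Conn ω₁ᶜ a b)) (decide (G₁.Conn ω₁ᶜ a h₁)) (decide (G₁.Conn ω₁ᶜ b h₁))
          (decide (G₂.Conn ω₂ᶜ c d)) (decide (G₂.Conn ω₂ᶜ h₂ c)) (decide (G₂.Conn ω₂ᶜ h₂ d)) false)) : ℝ) =
        ((G₁.pTop ω₁ a b h₁ * G₂.pTop ω₂ c d h₂ : ℤ) : ℝ) := by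
    intro ω₁ ω₂
    rw [bridge_kernel_true _ _ _ _ _ _ _ _ _ _ _ _ (G₁.tr3_tri ω₁ a b h₁) (G₁.tr3_tri ω₁ᶜ a b h₁)
      (G₂.tr3_tri' ω₂ c d h₂) (G₂.tr3_tri' ω₂ᶜ c d h₂), prod_top_split]
    unfold pTop
    rw [decide_eq_decide.2 (conn_comm (G := G₂) (ω := ω₂) (u := h₂) (v := c)),
      decide_eq_decide.2 (conn_comm (G := G₂) (ω := ω₂) (u := h₂) (v := d))]
  have hF : ∀ (ω₁ : Config E₁) (ω₂ : Config E₂),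
      (kplusZ (rowOf4 (bridgeRowVec (decide (G₁.Conn ω₁ a b)) (decide (G₁.Conn ω₁ a h₁)) (decide (G₁.Conn ω₁ b h₁))
          (decide (G₂.Conn ω₂ c d)) (decide (G₂.Conn ω₂ h₂ c)) (decide (G₂.Conn ω₂ h₂ d)) false))
        (rowOf4 (bridgeRowVec (decide (G₁.Conn ω₁ᶜ a b)) (decide (G₁.Conn ω₁ᶜ a h₁)) (decide (G₁.Conn ω₁ᶜ b h₁))
          (decide (G₂.Conn ω₂ᶜ c d)) (decide (G₂.Conn ω₂ᶜ h₂ c)) (decide (G₂.Conn ω₂ᶜ h₂ d)) true)) : ℝ) =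
        -((G₁.qLiab ω₁ a b h₁ * G₂.qLiab ω₂ c d h₂ : ℤ) : ℝ) := by
    intro ω₁ ω₂
    rw [bridge_kernel_false _ _ _ _ _ _ _ _ _ _ _ _ (G₁.tr3_tri ω₁ a b h₁) (G₁.tr3_tri ω₁ᶜ a b h₁)
      (G₂.tr3_tri' ω₂ c d h₂) (G₂.tr3_tri' ω₂ᶜ c d h₂), prod_liab_split]
    unfold qLiab
    rw [decide_eq_decide.2 (conn_comm (G := G₂) (ω := ω₂ᶜ) (u := h₂) (v := c)),
      decide_eq_decide.2 (conn_comm (G := G₂) (ω := ω₂ᶜ) (u := h₂) (v := d))]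
    push_cast
    ring
  simp only [hT, hF]
  push_cast
  rw [Finset.sum_mul_sum, Finset.sum_mul_sum]
  simp only [Finset.sum_add_distrib, Finset.sum_neg_distrib]
  ring

/-- **THE 2|2 BRIDGE CASE OF LEMMA B⁺**: the C-011 class sum of a 1-sum with two marks on each side is
nonnegative — no induction hypothesis needed. -/
theorem cubeSumC011_bridgeSum_nonneg (a b : V₁) (c d : V₂) :
    0 ≤ (G₁.bridgeSum G₂ h₁ h₂).cubeSumC011 ![Sum.inl a, Sum.inl b, Sum.inr c, Sum.inr d] := by
  rw [G₁.cubeSumC011_bridgeSum_eq G₂ h₁ h₂ a b c d]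
  have hq1 := G₁.sum_qLiab_le_sum_pTop a b h₁
  have hq2 := G₂.sum_qLiab_le_sum_pTop c d h₂
  have hn1 : 0 ≤ ∑ ω₁ : Config E₁, G₁.qLiab ω₁ a b h₁ := Finset.sum_nonneg fun ω _ => G₁.qLiab_nonneg ω a b h₁
  have hn2 : 0 ≤ ∑ ω₂ : Config E₂, G₂.qLiab ω₂ c d h₂ := Finset.sum_nonneg fun ω _ => G₂.qLiab_nonneg ω c d h₂
  have := mul_le_mul hq1 hq2 hn2 (le_trans hn1 hq1)
  exact_mod_cast sub_nonneg.2 this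

end Bridge

end MultiGraph

end PercRepro
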